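import Summits.AtomisticToContinuum.Crystallization.Theses.ExcessDecayLiouville
import Literature.MathematicalPhysics.StatisticalMechanics.CrystallizationLocalLimit
import Literature.MathematicalPhysics.StatisticalMechanics.LennardJonesClusters

/-!
# Route `ExcessDecayLiouville`, item stmt-AtomisticToContinuum-9337 `LimitGlue`

`FineGrains → IsCrystallizing lennardJones 3`: fine affine-hcp grains at every scale in large
Lennard-Jones ground states give the Blanc–Lewin crystallization statement (Blanc–Lewin 2015,
§2.1 (15)–(17), conjunct (ii)), by compactness bookkeeping.

Given ground states `x N`, apply `FineGrains` with radius `k + 1` and tolerance `1/(k+1)` to get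
thresholds `N₀ k`, a strictly increasing `φ₀ k ≥ N₀ k` and grain data `(c_k, t_k, A_k)` (centre,
two sublattice translations, admissible cell).  Recentre at `c_k`; reduce the translations modulo
`A_k Λ` (`exists_mem_span_norm_sub_le`, `ZSpan.fract`) so that they are bounded; admissible cells
satisfy `0.945 ‖v‖ ≤ ‖A v‖` and `‖A‖ ≤ 0.995` (`adm_lower`, `adm_upper`), so Bolzano–Weierstrass in
`(E →L E) × (Fin 2 → E)` extracts `A_k → A₀`, `t_k → t₀` with `A₀` still bounded below
(`lower_of_tendsto`), hence invertible.  The limit periodic configuration has lattice `A₀ Λ`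
(`ZLattice.comap` through `A₀⁻¹`; `Λ = barlowPeriodLattice 0 1 (2√(2/3)) 1`,
`mem_periodLattice_iff`) and motif `{t₀ 0, t₀ 1}` reduced modulo the lattice
(`exists_periodicConfiguration_two`).  On a fixed ball the sites of `(t_k, A_k)` and `(t₀, A₀)`
are uniformly close (`dist_sites_le`), so the two-way matching passes to the limit configuration
and `PeriodicConfiguration.tendsto_sum_of_eventually_near'` (with the uniform minimal distance
`LennardJonesMinimalDistance_holds`) gives local convergence with multiplicity `m ≡ 1` along
`φ₀ ∘ ψ` with translations `-c`.  An affinely strained hcp two-lattice is still a periodic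
configuration, so no control of the residual strain is needed.
-/

noncomputable section

namespace Summit.AtomisticToContinuum.Crystallization.Theorems

open Literature.MathematicalPhysics.StatisticalMechanics
open Filter Topology Metric Set

namespace ExcessDecayLiouvilleLimitGlue

section Generic

variable {V : Type*} [NormedAddCommGroup V] [NormedSpace ℝ V]

/-- **Admissible cells are uniformly bounded below**: `‖A - 0.97 R‖ ≤ 1/40` for a linear isometry
`R` gives `0.945 ‖v‖ ≤ ‖A v‖`. [folklore] -/
theorem adm_lower {A : V →L[ℝ] V} {R : V ≃ₗᵢ[ℝ] V}
    (h : ‖A - (97 / 100 : ℝ) • (R.toContinuousLinearEquiv : V →L[ℝ] V)‖ ≤ 1 / 40) (v : V) :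
    (189 / 200 : ℝ) * ‖v‖ ≤ ‖A v‖ := by
  have h1 : ‖(A - (97 / 100 : ℝ) • (R.toContinuousLinearEquiv : V →L[ℝ] V)) v‖ ≤ 1 / 40 * ‖v‖ :=
    (ContinuousLinearMap.le_opNorm _ _).trans (mul_le_mul_of_nonneg_right h (norm_nonneg _))
  have h2 : ‖((97 / 100 : ℝ) • (R.toContinuousLinearEquiv : V →L[ℝ] V)) v‖ = 97 / 100 * ‖v‖ := by
    simp [norm_smul]
  have h3 : ((97 / 100 : ℝ) • (R.toContinuousLinearEquiv : V →L[ℝ] V)) v =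
      A v - (A - (97 / 100 : ℝ) • (R.toContinuousLinearEquiv : V →L[ℝ] V)) v := by
    simp
  have h4 : ‖((97 / 100 : ℝ) • (R.toContinuousLinearEquiv : V →L[ℝ] V)) v‖ ≤
      ‖A v‖ + ‖(A - (97 / 100 : ℝ) • (R.toContinuousLinearEquiv : V →L[ℝ] V)) v‖ := by
    rw [h3]; exact norm_sub_le _ _
  linarith

/-- **Admissible cells are uniformly bounded**: `‖A - 0.97 R‖ ≤ 1/40` for a linear isometry `R`
gives `‖A‖ ≤ 0.995`. [folklore] -/
theorem adm_upper {A : V →L[ℝ] V} {R : V ≃ₗᵢ[ℝ] V}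
    (h : ‖A - (97 / 100 : ℝ) • (R.toContinuousLinearEquiv : V →L[ℝ] V)‖ ≤ 1 / 40) :
    ‖A‖ ≤ 199 / 200 := by
  have hR : ‖(R.toContinuousLinearEquiv : V →L[ℝ] V)‖ ≤ 1 :=
    ContinuousLinearMap.opNorm_le_bound _ zero_le_one fun v => by simp
  have h1 : ‖(97 / 100 : ℝ) • (R.toContinuousLinearEquiv : V →L[ℝ] V)‖ ≤ 97 / 100 := by
    rw [norm_smul, Real.norm_of_nonneg (by norm_num : (0 : ℝ) ≤ 97 / 100)]
    nlinarith
  have h2 := norm_le_insert' A ((97 / 100 : ℝ) • (R.toContinuousLinearEquiv : V →L[ℝ] V))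
  linarith

/-- **Distance between corresponding sites of two affine lattices** `p₁ + B₁ z`, `p₂ + B₂ z`, in
terms of `‖p₁ - p₂‖`, `‖B₁ - B₂‖` and the position of the first site, when `B₁` is bounded
below by `λ`. [folklore] -/
theorem dist_sites_le {p₁ p₂ : V} {B₁ B₂ : V →L[ℝ] V} {lam : ℝ} (hlam : 0 < lam)
    (hB₁ : ∀ v, lam * ‖v‖ ≤ ‖B₁ v‖) (z : V) :
    dist (p₁ + B₁ z) (p₂ + B₂ z) ≤ ‖p₁ - p₂‖ + ‖B₁ - B₂‖ * ((‖p₁ + B₁ z‖ + ‖p₁‖) / lam) := by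
  have hz : ‖z‖ ≤ (‖p₁ + B₁ z‖ + ‖p₁‖) / lam := by
    rw [le_div_iff₀ hlam]
    have h1 := hB₁ z
    have h2 : ‖B₁ z‖ ≤ ‖p₁ + B₁ z‖ + ‖p₁‖ := by
      have h := norm_sub_le (p₁ + B₁ z) p₁
      rwa [add_sub_cancel_left] at h
    linarith
  calc dist (p₁ + B₁ z) (p₂ + B₂ z) = ‖(p₁ - p₂) + (B₁ - B₂) z‖ := by
        rw [dist_eq_norm]
        congr 1
        simp only [FunLike.coe_sub, Pi.sub_apply]
        abel
    _ ≤ ‖p₁ - p₂‖ + ‖(B₁ - B₂) z‖ := norm_add_le _ _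
    _ ≤ ‖p₁ - p₂‖ + ‖B₁ - B₂‖ * ‖z‖ := by
        gcongr
        exact ContinuousLinearMap.le_opNorm _ _
    _ ≤ ‖p₁ - p₂‖ + ‖B₁ - B₂‖ * ((‖p₁ + B₁ z‖ + ‖p₁‖) / lam) := by
        gcongr

/-- **Lower bounds pass to the limit** in the operator-norm topology. [folklore] -/
theorem lower_of_tendsto {B : ℕ → V →L[ℝ] V} {B₀ : V →L[ℝ] V} {lam : ℝ}
    (h : Tendsto B atTop (𝓝 B₀)) (hB : ∀ k v, lam * ‖v‖ ≤ ‖B k v‖) (v : V) :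
    lam * ‖v‖ ≤ ‖B₀ v‖ := by
  have hev : Tendsto (fun k => B k v) atTop (𝓝 (B₀ v)) :=
    ((ContinuousLinearMap.apply ℝ V v).continuous.tendsto _).comp h
  exact ge_of_tendsto hev.norm (Eventually.of_forall fun k => hB k v)

/-- **Reduction modulo a lattice, through an injective cell map**: for a basis `b` of a
finite-dimensional space and an injective (hence bijective) linear `A`, every `y` is within
`‖A‖ ∑ ‖b i‖` of `A z` for some `z ∈ ℤ b`. [folklore] -/
theorem exists_mem_span_norm_sub_le [FiniteDimensional ℝ V] {ι : Type*} [Fintype ι]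
    (b : Module.Basis ι ℝ V) (A : V →L[ℝ] V) (hA : Function.Injective A) (y : V) :
    ∃ z ∈ Submodule.span ℤ (Set.range b), ‖y - A z‖ ≤ ‖A‖ * ∑ i, ‖b i‖ := by
  obtain ⟨x, rfl⟩ : ∃ x, A x = y :=
    (LinearMap.injective_iff_surjective (f := (A : V →ₗ[ℝ] V))).1 hA y
  refine ⟨ZSpan.floor b x, (ZSpan.floor b x).2, ?_⟩
  have : A x - A (ZSpan.floor b x) = A (ZSpan.fract b x) := by
    rw [ZSpan.fract_apply, map_sub]
  rw [this]
  exact (A.le_opNorm _).trans (mul_le_mul_of_nonneg_left (ZSpan.norm_fract_le b x) (norm_nonneg _))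

end Generic

/-- **A full-rank lattice and two sublattice translations form a periodic configuration** whose
point set is `{t m + g : m ∈ {0,1}, g ∈ G}` (motif `{t 0, t 1}` reduced modulo `G`: a singleton
if `t 1 - t 0 ∈ G`). [folklore] -/
theorem exists_periodicConfiguration_two {d : ℕ} (G : Submodule ℤ (EuclideanSpace ℝ (Fin d)))
    [DiscreteTopology G] [IsZLattice ℝ G] (t : Fin 2 → EuclideanSpace ℝ (Fin d)) :
    ∃ P : PeriodicConfiguration d, P.lattice = G ∧
      P.points = {s | ∃ m : Fin 2, ∃ g ∈ G, s = t m + g} := by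
  classical
  by_cases h10 : t 1 - t 0 ∈ G
  · refine ⟨⟨G, inferInstance, inferInstance, {t 0}, by simp, ?_⟩, rfl, ?_⟩
    · intro x hx y hy _
      rw [Finset.mem_singleton] at hx hy
      rw [hx, hy]
    · ext s
      simp only [PeriodicConfiguration.points, Finset.mem_singleton, Set.mem_setOf_eq]
      constructor
      · rintro ⟨y, rfl, g, hg, rfl⟩
        exact ⟨0, g, hg, rfl⟩
      · rintro ⟨m, g, hg, rfl⟩
        have hm : t m - t 0 ∈ G := by
          fin_cases m
          · simp
          · exact h10
        exact ⟨t 0, rfl, (t m - t 0) + g, G.add_mem hm hg, by abel⟩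
  · refine ⟨⟨G, inferInstance, inferInstance, {t 0, t 1}, by simp, ?_⟩, rfl, ?_⟩
    · intro x hx y hy hxy
      simp only [Finset.mem_insert, Finset.mem_singleton] at hx hy
      rcases hx with rfl | rfl <;> rcases hy with rfl | rfl
      · rfl
      · exact absurd (by simpa using G.neg_mem hxy) h10
      · exact absurd hxy h10
      · rfl
    · ext s
      simp only [PeriodicConfiguration.points, Finset.mem_insert, Finset.mem_singleton,
        Set.mem_setOf_eq]
      constructor
      · rintro ⟨y, hy, g, hg, rfl⟩
        rcases hy with rfl | rfl
        · exact ⟨0, g, hg, rfl⟩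
        · exact ⟨1, g, hg, rfl⟩
      · rintro ⟨m, g, hg, rfl⟩
        refine ⟨t m, ?_, g, hg, rfl⟩
        fin_cases m
        · exact Or.inl rfl
        · exact Or.inr rfl

/-- **The period lattice of the route**, `Λ = ℤ u + ℤ v + ℤ h e₃` (`u = triangularVec₁ 1`,
`v = triangularVec₂ 1`), is the `ZSpan` lattice `barlowPeriodLattice` with window sum `0`
(sequence `s ≡ 0`), `a = 1` and period `p = 1`. [folklore] -/
theorem mem_periodLattice_iff {h : ℝ} (hh : h ≠ 0) {z : EuclideanSpace ℝ (Fin 3)} :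
    z ∈ barlowPeriodLattice (fun _ => (0 : ℤ)) (one_ne_zero : (1 : ℝ) ≠ 0) hh
        (one_ne_zero : (1 : ℕ) ≠ 0) ↔
      ∃ i j k : ℤ, z = (i : ℝ) • triangularVec₁ 1 + (j : ℝ) • triangularVec₂ 1 +
        (k : ℝ) • layerNormal h := by
  constructor
  · intro hz
    obtain ⟨n₀, n₁, n₂, rfl⟩ := exists_eq_of_mem_barlowPeriodLattice _ _ hh _ hz
    exact ⟨n₀, n₁, n₂, by simp [haggWindow]⟩
  · rintro ⟨i, j, k, rfl⟩
    simpa [haggWindow] using sum_smul_mem_barlowPeriodLattice (fun _ => (0 : ℤ))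
      (one_ne_zero : (1 : ℝ) ≠ 0) hh (one_ne_zero : (1 : ℕ) ≠ 0) i j k

end ExcessDecayLiouvilleLimitGlue

open ExcessDecayLiouvilleLimitGlue in
/-- **Item stmt-AtomisticToContinuum-9337** (`LimitGlue`, route `ExcessDecayLiouville`; Blanc–Lewin
2015, §2.1 (ii) bookkeeping): fine hcp grains at every scale (`FineGrains`) imply the
Blanc–Lewin crystallization statement `IsCrystallizing lennardJones 3`.  Given ground states
`x N`, take `ρ_k = k + 1`, `ε_k = 1/(k+1)`, `φ₀ k ≥ N₀(ρ_k, ε_k)` strictly increasing and grain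
data `(c_k, t_k, A_k)`; recentre at `c_k`, reduce the sublattice translations modulo `A_k Λ`
(bounded), extract `A_k → A₀`, `t_k → t₀` (admissible cells are bounded with a uniform lower
bound, so `A₀` is invertible and `A₀ Λ` is a full-rank discrete lattice); the limit periodic
configuration has lattice `A₀ Λ` and motif `{t₀ 0, t₀ 1}` reduced modulo `A₀ Λ`, and on every
fixed ball the matching error tends to `0`, so the local-convergence criterion
`PeriodicConfiguration.tendsto_sum_of_eventually_near'` applies with the uniform minimal distance
of Lennard-Jones ground states (`LennardJonesMinimalDistance_holds`), multiplicity `m ≡ 1`. -/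
theorem limitGlue_proof :
    Summit.AtomisticToContinuum.Crystallization.Theses.ExcessDecayLiouville.LimitGlue := by
  unfold Summit.AtomisticToContinuum.Crystallization.Theses.ExcessDecayLiouville.LimitGlue
  intro hFG x hx
  -- the period lattice `Λ` as a `ZSpan`
  have hH : (2 * Real.sqrt (2 / 3) : ℝ) ≠ 0 := by positivity
  set L := barlowPeriodLattice (fun _ => (0 : ℤ)) (one_ne_zero : (1 : ℝ) ≠ 0) hH
    (one_ne_zero : (1 : ℕ) ≠ 0) with hLdef
  set b := barlowPeriodBasis (fun _ => (0 : ℤ)) (one_ne_zero : (1 : ℝ) ≠ 0) hH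
    (one_ne_zero : (1 : ℕ) ≠ 0) with hbdef
  have hLb : L = Submodule.span ℤ (Set.range b) := rfl
  haveI : DiscreteTopology L := by rw [hLb]; infer_instance
  haveI : IsZLattice ℝ L := (inferInstance : IsZLattice ℝ (Submodule.span ℤ (Set.range b)))
  have hΛ : ∀ z, z ∈ {z : EuclideanSpace ℝ (Fin 3) | ∃ i j k : ℤ, z = (i : ℝ) • triangularVec₁ 1 +
      (j : ℝ) • triangularVec₂ 1 + (k : ℝ) • layerNormal (2 * Real.sqrt (2 / 3))} ↔ z ∈ L :=
      fun z => by
    rw [Set.mem_setOf_eq, hLdef, mem_periodLattice_iff]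
  -- the uniform minimal distance of Lennard-Jones ground states
  obtain ⟨δ, hδ, hδsep⟩ := LennardJonesMinimalDistance_holds
  -- Step 1: fine grains at radius `k + 1`, tolerance `1 / (k + 1)`
  have key : ∀ k : ℕ, ∃ N₀ : ℕ, ∀ N, N₀ ≤ N → ∃ (c : EuclideanSpace ℝ (Fin 3))
      (t : Fin 2 → EuclideanSpace ℝ (Fin 3))
      (A : EuclideanSpace ℝ (Fin 3) →L[ℝ] EuclideanSpace ℝ (Fin 3)),
      (∃ R : EuclideanSpace ℝ (Fin 3) ≃ₗᵢ[ℝ] EuclideanSpace ℝ (Fin 3), ‖A - (97 / 100 : ℝ) •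
        (R.toContinuousLinearEquiv : EuclideanSpace ℝ (Fin 3) →L[ℝ] EuclideanSpace ℝ (Fin 3))‖ ≤
        1 / 40) ∧
      (∀ p ∈ Set.range (x N), dist p c ≤ (k : ℝ) + 1 →
        ∃ m : Fin 2, ∃ z ∈ L, dist p (t m + A z) ≤ 1 / ((k : ℝ) + 1)) ∧
      (∀ m : Fin 2, ∀ z ∈ L, dist (t m + A z) c ≤ (k : ℝ) + 1 →
        ∃ p ∈ Set.range (x N), dist p (t m + A z) ≤ 1 / ((k : ℝ) + 1)) := by
    intro k
    obtain ⟨N₀, hN₀⟩ := hFG ((k : ℝ) + 1) (1 / ((k : ℝ) + 1)) (by positivity) (by positivity)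
    refine ⟨N₀, fun N hN => ?_⟩
    obtain ⟨c, t, A, hA, h1, h2⟩ := hN₀ N hN (x N) (hx N)
    refine ⟨c, t, A, hA, fun p hp hpc => ?_, fun m z hz hd => ?_⟩
    · obtain ⟨m, z, hz, hd⟩ := h1 p hp hpc
      exact ⟨m, z, (hΛ z).1 hz, hd⟩
    · exact h2 m z ((hΛ z).2 hz) hd
  choose N₀ hN₀ using key
  obtain ⟨φ₀, hφ₀, hφ₀N⟩ : ∃ φ₀ : ℕ → ℕ, StrictMono φ₀ ∧ ∀ k, N₀ k ≤ φ₀ k :=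
    extraction_forall_of_eventually' (fun k => ⟨N₀ k, fun n hn => hn⟩)
  choose c t A hAdm hNear₁ hNear₂ using fun k => hN₀ k (φ₀ k) (hφ₀N k)
  -- bounds on the cells `A k`
  have hlow : ∀ k v, (189 / 200 : ℝ) * ‖v‖ ≤ ‖A k v‖ := fun k v =>
    (hAdm k).elim fun R hR => adm_lower hR v
  have hup : ∀ k, ‖A k‖ ≤ 199 / 200 := fun k => (hAdm k).elim fun R hR => adm_upper hR
  have inj_of_low : ∀ B : EuclideanSpace ℝ (Fin 3) →L[ℝ] EuclideanSpace ℝ (Fin 3),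
      (∀ v, (189 / 200 : ℝ) * ‖v‖ ≤ ‖B v‖) → Function.Injective B := fun B hB v v' hvv' => by
    by_contra hne
    have h1 := hB (v - v')
    rw [map_sub, hvv', sub_self, norm_zero] at h1
    have : 0 < ‖v - v'‖ := norm_pos_iff.2 (sub_ne_zero.2 hne)
    linarith
  -- Step 2: normalise the sublattice translations modulo `A k Λ`
  set T : ℝ := 199 / 200 * ∑ i, ‖b i‖ with hTdef
  have hT0 : 0 ≤ T := by positivity
  have hnorm : ∀ k m, ∃ z ∈ L, ‖(t k m - c k) - A k z‖ ≤ T := fun k m => by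
    obtain ⟨z, hz, hle⟩ :=
      exists_mem_span_norm_sub_le b (A k) (inj_of_low _ (hlow k)) (t k m - c k)
    exact ⟨z, hz, hle.trans (mul_le_mul_of_nonneg_right (hup k)
      (Finset.sum_nonneg fun i _ => norm_nonneg _))⟩
  choose ζ hζL hζ using hnorm
  set t' := fun k m => (t k m - c k) - A k (ζ k m) with ht'def
  have ht'le : ∀ k m, ‖t' k m‖ ≤ T := hζ
  have ht'id : ∀ k m z, t' k m + A k z + c k = t k m + A k (z - ζ k m) := fun k m z => by
    simp only [ht'def, map_sub]; abel
  -- Step 3: Bolzano–Weierstrass in `(E →L E) × (Fin 2 → E)`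
  set w := fun k => (A k, t' k) with hwdef
  have hbdd : Bornology.IsBounded (Set.range w) := by
    refine isBounded_iff_forall_norm_le.2 ⟨max (199 / 200) T, ?_⟩
    rintro _ ⟨k, rfl⟩
    rw [hwdef, Prod.norm_def]
    exact max_le_max (hup k) ((pi_norm_le_iff_of_nonneg hT0).2 fun m => ht'le k m)
  obtain ⟨⟨A₀, t₀⟩, -, ψ, hψ, hlim⟩ :=
    tendsto_subseq_of_bounded hbdd fun k => Set.mem_range_self k
  have hA₀ : Tendsto (fun j => A (ψ j)) atTop (𝓝 A₀) := hlim.fst_nhds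
  have ht₀ : Tendsto (fun j => t' (ψ j)) atTop (𝓝 t₀) := hlim.snd_nhds
  have ht₀le : ∀ m, ‖t₀ m‖ ≤ T := fun m =>
    le_of_tendsto ((tendsto_pi_nhds.1 ht₀ m).norm) (Eventually.of_forall fun j => ht'le (ψ j) m)
  -- Step 4: the limit cell is invertible
  have hlow₀ : ∀ v, (189 / 200 : ℝ) * ‖v‖ ≤ ‖A₀ v‖ :=
    lower_of_tendsto hA₀ (fun j v => hlow (ψ j) v)
  have hinj₀ : Function.Injective
      (A₀ : EuclideanSpace ℝ (Fin 3) →ₗ[ℝ] EuclideanSpace ℝ (Fin 3)) := inj_of_low A₀ hlow₀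
  set Ae := (LinearEquiv.ofInjectiveEndo _ hinj₀).toContinuousLinearEquiv with hAedef
  have hAe : ∀ v, Ae v = A₀ v := fun v => rfl
  -- Step 5: the limit periodic configuration, lattice `A₀ Λ`, motif `{t₀ 0, t₀ 1}` reduced
  set G := ZLattice.comap ℝ L Ae.symm.toLinearMap with hGdef
  have hG' : ∀ g, g ∈ G ↔ Ae.symm g ∈ L := fun g => by
    rw [hGdef, ZLattice.comap, Submodule.mem_comap]; rfl
  have hG : ∀ g, g ∈ G ↔ ∃ z ∈ L, g = A₀ z := fun g => by
    rw [hG']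
    constructor
    · intro hg
      exact ⟨Ae.symm g, hg, by rw [← hAe, ContinuousLinearEquiv.apply_symm_apply]⟩
    · rintro ⟨z, hz, rfl⟩
      rwa [← hAe, ContinuousLinearEquiv.symm_apply_apply]
  haveI : DiscreteTopology G := by rw [hGdef]; infer_instance
  haveI : IsZLattice ℝ G := (inferInstance : IsZLattice ℝ (ZLattice.comap ℝ L Ae.symm.toLinearMap))
  obtain ⟨P, -, hPp⟩ := exists_periodicConfiguration_two G t₀
  have hP : ∀ s, s ∈ P.points ↔ ∃ m : Fin 2, ∃ z ∈ L, s = t₀ m + A₀ z := fun s => by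
    rw [hPp, Set.mem_setOf_eq]
    constructor
    · rintro ⟨m, g, hg, rfl⟩
      obtain ⟨z, hz, rfl⟩ := (hG g).1 hg
      exact ⟨m, z, hz, rfl⟩
    · rintro ⟨m, z, hz, rfl⟩
      exact ⟨m, A₀ z, (hG _).2 ⟨z, hz, rfl⟩, rfl⟩
  -- Step 6: conclusion by the local-convergence criterion
  refine ⟨fun j => φ₀ (ψ j), fun j => -c (ψ j), P, fun _ => 1, hφ₀.comp hψ, fun _ _ => le_rfl,
    fun _ _ _ => rfl, fun f hfc hf => ?_⟩
  have hsep : ∀ j (i i' : Fin (φ₀ (ψ j))), i ≠ i' →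
      δ ≤ dist (x (φ₀ (ψ j)) i + -c (ψ j)) (x (φ₀ (ψ j)) i' + -c (ψ j)) := fun j i i' hii' => by
    rw [dist_add_right]; exact hδsep _ _ (hx _) i i' hii'
  refine P.tendsto_sum_of_eventually_near' (fun j i => x (φ₀ (ψ j)) i + -c (ψ j)) hδ hsep
    (fun R ε hε => ?_) hfc hf
  -- the two-way matching on `‖·‖ ≤ R` with tolerance `ε`, eventually
  set ε' := min ε 1
  have hε' : 0 < ε' := lt_min hε one_pos
  have hε'ε : ε' ≤ ε := min_le_left _ _
  have hε'1 : ε' ≤ 1 := min_le_right _ _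
  set K : ℝ := (|R| + 1 + T) / (189 / 200) with hKdef
  have e1 : ∀ᶠ j in atTop, 1 / ((ψ j : ℝ) + 1) ≤ ε' / 2 := by
    have h1 : Tendsto (fun j => 1 / ((ψ j : ℝ) + 1)) atTop (𝓝 0) :=
      tendsto_one_div_add_atTop_nhds_zero_nat.comp hψ.tendsto_atTop
    exact h1.eventually_le_const (by positivity)
  have e2 : ∀ᶠ j in atTop, |R| + 1 ≤ (ψ j : ℝ) :=
    (tendsto_natCast_atTop_atTop.comp hψ.tendsto_atTop).eventually_ge_atTop _
  have e3 : ∀ᶠ j in atTop, dist (t' (ψ j)) t₀ ≤ ε' / 4 :=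
    (tendsto_iff_dist_tendsto_zero.1 ht₀).eventually_le_const (by positivity)
  have e4 : ∀ᶠ j in atTop, ‖A (ψ j) - A₀‖ * K ≤ ε' / 4 := by
    have h1 : Tendsto (fun j => ‖A (ψ j) - A₀‖ * K) atTop (𝓝 0) := by
      simpa using (tendsto_iff_norm_sub_tendsto_zero.1 hA₀).mul_const K
    exact h1.eventually_le_const (by positivity)
  filter_upwards [e1, e2, e3, e4] with j hj1 hj2 hj3 hj4
  have hRabs : R ≤ |R| := le_abs_self R
  constructor
  · -- every limit site in the ball has a particle nearby
    intro s hs hsR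
    obtain ⟨m, z, hz, rfl⟩ := (hP s).1 hs
    have hd : dist (t₀ m + A₀ z) (t' (ψ j) m + A (ψ j) z) ≤ ε' / 2 := by
      have h0 := dist_sites_le (p₁ := t₀ m) (p₂ := t' (ψ j) m) (B₁ := A₀) (B₂ := A (ψ j))
        (by norm_num : (0 : ℝ) < 189 / 200) hlow₀ z
      have h1 : ‖t₀ m - t' (ψ j) m‖ ≤ ε' / 4 := by
        rw [← dist_eq_norm, dist_comm]; exact (dist_le_pi_dist _ _ m).trans hj3
      have h2 : ‖A₀ - A (ψ j)‖ * ((‖t₀ m + A₀ z‖ + ‖t₀ m‖) / (189 / 200)) ≤ ε' / 4 := by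
        rw [norm_sub_rev]
        refine le_trans (mul_le_mul_of_nonneg_left ?_ (norm_nonneg _)) hj4
        rw [hKdef]
        gcongr
        · linarith
        · exact ht₀le m
      linarith
    have hs'norm : ‖t' (ψ j) m + A (ψ j) z‖ ≤ (ψ j : ℝ) + 1 := by
      have h1 := norm_le_insert' (t' (ψ j) m + A (ψ j) z) (t₀ m + A₀ z)
      rw [← dist_eq_norm, dist_comm] at h1; linarith
    obtain ⟨p, ⟨i, rfl⟩, hpi⟩ := hNear₂ (ψ j) m (z - ζ (ψ j) m) (L.sub_mem hz (hζL _ _))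
      (by rw [← ht'id, dist_eq_norm, add_sub_cancel_right]; exact hs'norm)
    refine ⟨i, ?_⟩
    have hpi' : dist (x (φ₀ (ψ j)) i + -c (ψ j)) (t' (ψ j) m + A (ψ j) z) ≤ ε' / 2 := by
      rw [← dist_add_right _ _ (c (ψ j)), neg_add_cancel_right, ht'id]
      exact hpi.trans hj1
    calc dist (x (φ₀ (ψ j)) i + -c (ψ j)) (t₀ m + A₀ z)
        ≤ dist (x (φ₀ (ψ j)) i + -c (ψ j)) (t' (ψ j) m + A (ψ j) z) +
            dist (t' (ψ j) m + A (ψ j) z) (t₀ m + A₀ z) := dist_triangle _ _ _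
      _ ≤ ε' / 2 + ε' / 2 := add_le_add hpi' (by rw [dist_comm]; exact hd)
      _ ≤ ε := by linarith
  · -- every particle in the ball has a limit site nearby
    intro i hi
    have hic : dist (x (φ₀ (ψ j)) i) (c (ψ j)) ≤ (ψ j : ℝ) + 1 := by
      rw [dist_eq_norm, sub_eq_add_neg]; linarith
    obtain ⟨m, z, hz, hd⟩ := hNear₁ (ψ j) _ (Set.mem_range_self i) hic
    set z' := z + ζ (ψ j) m with hz'def
    have hid : t' (ψ j) m + A (ψ j) z' + c (ψ j) = t (ψ j) m + A (ψ j) z := by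
      rw [ht'id, hz'def, add_sub_cancel_right]
    have hd' : dist (x (φ₀ (ψ j)) i + -c (ψ j)) (t' (ψ j) m + A (ψ j) z') ≤ ε' / 2 := by
      rw [← dist_add_right _ _ (c (ψ j)), neg_add_cancel_right, hid]
      exact hd.trans hj1
    have hs'norm : ‖t' (ψ j) m + A (ψ j) z'‖ ≤ |R| + 1 := by
      have h1 := norm_le_insert' (t' (ψ j) m + A (ψ j) z') (x (φ₀ (ψ j)) i + -c (ψ j))
      rw [← dist_eq_norm, dist_comm] at h1; linarith
    have hd2 : dist (t' (ψ j) m + A (ψ j) z') (t₀ m + A₀ z') ≤ ε' / 2 := by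
      have h0 := dist_sites_le (p₁ := t' (ψ j) m) (p₂ := t₀ m) (B₁ := A (ψ j)) (B₂ := A₀)
        (by norm_num : (0 : ℝ) < 189 / 200) (hlow (ψ j)) z'
      have h1 : ‖t' (ψ j) m - t₀ m‖ ≤ ε' / 4 := by
        rw [← dist_eq_norm]; exact (dist_le_pi_dist _ _ m).trans hj3
      have h2 : ‖A (ψ j) - A₀‖ * ((‖t' (ψ j) m + A (ψ j) z'‖ + ‖t' (ψ j) m‖) / (189 / 200)) ≤
          ε' / 4 := by
        refine le_trans (mul_le_mul_of_nonneg_left ?_ (norm_nonneg _)) hj4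
        rw [hKdef]
        gcongr
        exact ht'le _ m
      linarith
    refine ⟨t₀ m + A₀ z', (hP _).2 ⟨m, z', L.add_mem hz (hζL _ _), rfl⟩, ?_⟩
    calc dist (x (φ₀ (ψ j)) i + -c (ψ j)) (t₀ m + A₀ z')
        ≤ dist (x (φ₀ (ψ j)) i + -c (ψ j)) (t' (ψ j) m + A (ψ j) z') +
            dist (t' (ψ j) m + A (ψ j) z') (t₀ m + A₀ z') := dist_triangle _ _ _
      _ ≤ ε' / 2 + ε' / 2 := add_le_add hd' hd2
      _ ≤ ε := by linarith

end Summit.AtomisticToContinuum.Crystallization.Theorems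

end
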